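import Mathlib

/-!
# Line `Sketch` (crux `DyadicWallCascade.HalfSpaceHierarchy`, stmt-AnomalousDissipation-18627):
# tool stub `stub_superCriticalMatchingInvertible` — super-critical matching is invertible

The idea card `octave-transfer-rpf` linearises the self-similar matching of the crux (a steady
Euler flow invariant under `X ↦ 2X`) as `M = 𝒜 − w • K`, where `K` (the Koopman operator of a
`4:1` expanding map) is an isometric embedding and `𝒜` (the octave cocycle) is invertible.  This
file proves the abstract "super-critical ⇒ invertible" half of the resulting dichotomy; it is pure
functional analysis over Mathlib (no fluid content).

**Statement.** Let `X` be a real Banach space, `K : X →L[ℝ] X` with `‖K x‖ = ‖x‖` for all `x`,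
`A : X ≃L[ℝ] X`, and `0 ≤ w` with `w * ‖A⁻¹‖ < 1`.  Then `A − w • K` is a unit of the Banach
algebra `X →L[ℝ] X` (i.e. a bi-continuous linear isomorphism).

**Proof (forward Neumann series).** In the Banach algebra `X →L[ℝ] X` (multiplication =
composition) factor `A − w • K = A * (1 − w • (A⁻¹ * K))`.  The isometry hypothesis gives
`‖K‖ ≤ 1`, hence `‖w • (A⁻¹ * K)‖ ≤ w * ‖A⁻¹‖ * ‖K‖ ≤ w * ‖A⁻¹‖ < 1`, so `1 − w • (A⁻¹ * K)` is a
unit by the geometric series (`isUnit_one_sub_of_norm_lt_one`, which only needs completeness of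
`X →L[ℝ] X`).  A continuous linear equivalence is a unit of the endomorphism ring
(`ContinuousLinearEquiv.toUnit`), and a product of units is a unit.  The degenerate cases `w = 0`
and `X` trivial need no separate treatment.

Source: folklore Neumann series (card `octave-transfer-rpf`, §First lemma); for context see
T. Kato, *Perturbation Theory for Linear Operators*, Ch. IV §1 (stability of bounded
invertibility).
-/

set_option linter.dupNamespace false

namespace Summit.AnomalousDissipation.AnomalousDissipation.Theorems.HalfSpaceHierarchy

/-- An isometric embedding has operator norm at most `1`. -/
private theorem opNorm_le_one_of_isometry {X : Type*} [NormedAddCommGroup X] [NormedSpace ℝ X]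
    (K : X →L[ℝ] X) (hK : ∀ x : X, ‖K x‖ = ‖x‖) : ‖K‖ ≤ 1 :=
  ContinuousLinearMap.opNorm_le_bound _ zero_le_one fun x => by simp [hK x]

/-- The Neumann-series factorisation `A − w • K = A * (1 − w • (A⁻¹ * K))` in the endomorphism
ring `X →L[ℝ] X` (multiplication = composition). -/
private theorem sub_smul_eq_mul_one_sub {X : Type*} [NormedAddCommGroup X] [NormedSpace ℝ X]
    (K : X →L[ℝ] X) (A : X ≃L[ℝ] X) (w : ℝ) :
    (A : X →L[ℝ] X) - w • K
      = (A : X →L[ℝ] X) * (1 - w • ((A.symm : X →L[ℝ] X) * K)) := by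
  ext x
  simp [mul_sub]

/-- **Tool stub `stub_superCriticalMatchingInvertible`** (crux stmt-AnomalousDissipation-18627, line
`Sketch`; card `octave-transfer-rpf`, abstract dichotomy, super-critical half).  If `K` is an
isometric embedding of a real Banach space `X`, `A` a continuous linear automorphism of `X`, and
`0 ≤ w` with `w * ‖A⁻¹‖ < 1`, then `A − w • K` is invertible in `X →L[ℝ] X`.  Proof: forward
Neumann series, `A − w • K = A * (1 − w • (A⁻¹ * K))` with `‖w • (A⁻¹ * K)‖ ≤ w * ‖A⁻¹‖ < 1`. -/
theorem stub_superCriticalMatchingInvertible :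
    ∀ (X : Type) [NormedAddCommGroup X] [NormedSpace ℝ X] [CompleteSpace X]
      (K : X →L[ℝ] X) (A : X ≃L[ℝ] X) (w : ℝ), 0 ≤ w →
      (∀ x : X, ‖K x‖ = ‖x‖) →
      w * ‖(A.symm : X →L[ℝ] X)‖ < 1 →
      IsUnit ((A : X →L[ℝ] X) - w • K) := by
  intro X _ _ _ K A w hw hK hlt
  -- `‖K‖ ≤ 1` from the isometry hypothesis.
  have hKn : ‖K‖ ≤ 1 := opNorm_le_one_of_isometry K hK
  -- The Neumann perturbation `t := w • (A⁻¹ * K)` has norm `< 1`.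
  have ht : ‖w • ((A.symm : X →L[ℝ] X) * K)‖ < 1 := by
    calc ‖w • ((A.symm : X →L[ℝ] X) * K)‖
        = w * ‖(A.symm : X →L[ℝ] X) * K‖ := by rw [norm_smul, Real.norm_of_nonneg hw]
      _ ≤ w * (‖(A.symm : X →L[ℝ] X)‖ * ‖K‖) := by gcongr; exact norm_mul_le _ _
      _ ≤ w * (‖(A.symm : X →L[ℝ] X)‖ * 1) := by gcongr
      _ = w * ‖(A.symm : X →L[ℝ] X)‖ := by ring
      _ < 1 := hlt
  -- `A` is a unit of the endomorphism ring, `1 - t` is a unit by the geometric series.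
  have hA : IsUnit (A : X →L[ℝ] X) := ⟨A.toUnit, rfl⟩
  rw [sub_smul_eq_mul_one_sub K A w]
  exact hA.mul (isUnit_one_sub_of_norm_lt_one ht)

end Summit.AnomalousDissipation.AnomalousDissipation.Theorems.HalfSpaceHierarchy
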